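import Summits.PneNP.PneNP.Theorems.PermanentDescentCollapseMakesPermanentEasyDefs
import Mathlib.GroupTheory.Perm.Fin
import Literature.LinearAlgebra.Matrix.PermanentLaplace

/-!
# Route PermanentDescent, crux `CollapseMakesPermanentEasy` (stmt-PneNP-16142), line `birth` v2 — `stub_laplaceWord`

Registered stub `stub_laplaceWord` of the skeleton `Cruxes/CollapseMakesPermanentEasy/Lines/birth.lean` (v2), over the
objects of `Theorems/PermanentDescentCollapseMakesPermanentEasyDefs.lean` (namespace
`Summit.PneNP.PneNP.Theorems.PermCert`): the Laplace expansion of the permanent along row `0`,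
transported to the row-major word encoding of 0/1 matrices (`matOfWord`, `permWord`, `minorWord`,
`laplaceSum`).

Proof. Side `0`: the index type `Fin 0` is empty, so the permanent is `1`
(`Matrix.permanent_isEmpty`). Side `k + 1`: the key re-indexing lemma `matOfWord_minorWord`
identifies the word matrix of `minorWord k j s` with the submatrix of `matOfWord (k+1) s` deleting
row `0` and column `j` (entry `(a, b)` of the minor word sits at letter `b + k·a < k·k`, whose
quotient and remainder by `k` are `a` and `b`, and `j.succAbove b = b + [j ≤ b]`); then the tree's
`Matrix.permanent_eq_sum_row_zero` is rewritten minor by minor, the row-`0` entries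
`[s[j]] · per = if s[j] then per else 0` (`boole_mul`), and the `Fin (k+1)`-indexed sum is turned
into the `List.range (k+1)` sum of `laplaceSum`.
-/

set_option linter.dupNamespace false -- `Summit.PneNP.PneNP.…`: summit = sub-problem name (D-0017 single-conjunct layout)

namespace Summit.PneNP.PneNP.Theorems.PermCert

open _root_.Computability Polynomial
open Literature.Computability.Complexity Literature.Computability.Complexity.Brick

/-- A sum over the mapped list `List.range n` is the sum over `Fin n`. [folklore] -/
private theorem sum_map_range_eq_sum_univ (f : ℕ → ℕ) (n : ℕ) :
    ((List.range n).map f).sum = ∑ i : Fin n, f i := by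
  rw [Fin.sum_univ_eq_sum_range]
  induction n with
  | zero => simp
  | succ n ih => rw [List.range_succ, List.map_append, List.sum_append, ih, Finset.sum_range_succ,
      List.map_singleton, List.sum_singleton]

/-- **Minors in the word encoding**: for `j : Fin (k+1)`, the `k × k` word matrix of
`minorWord k j s` is the submatrix of the `(k+1) × (k+1)` word matrix of `s` with row `0` and
column `j` deleted (rows re-indexed by `Fin.succ`, columns by `j.succAbove`). [folklore] -/
theorem matOfWord_minorWord (k : ℕ) (s : List Bool) (j : Fin (k + 1)) :
    matOfWord k (minorWord k (j : ℕ) s) = (matOfWord (k + 1) s).submatrix Fin.succ j.succAbove := by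
  ext a b
  have hk : 0 < k := b.pos
  have hb : (b : ℕ) < k := b.isLt
  have ht : (b : ℕ) + k * (a : ℕ) < k * k := by
    calc (b : ℕ) + k * (a : ℕ) < k + k * (a : ℕ) := by omega
      _ = k * ((a : ℕ) + 1) := by ring
      _ ≤ k * k := Nat.mul_le_mul_left k a.isLt
  have hmod : ((b : ℕ) + k * (a : ℕ)) % k = b := by
    rw [Nat.add_mul_mod_self_left, Nat.mod_eq_of_lt hb]
  have hdiv : ((b : ℕ) + k * (a : ℕ)) / k = a := by
    rw [Nat.add_mul_div_left _ _ hk, Nat.div_eq_of_lt hb, zero_add]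
  have hidx : ((j.succAbove b : Fin (k + 1)) : ℕ) + (k + 1) * ((Fin.succ a : Fin (k + 1)) : ℕ) =
      (b : ℕ) + (if (j : ℕ) ≤ b then 1 else 0) + (k + 1) * ((a : ℕ) + 1) := by
    rw [Fin.val_succ]
    by_cases h : (j : ℕ) ≤ b
    · rw [if_pos h, Fin.succAbove_of_le_castSucc _ _ (Fin.le_def.2 (by simpa using h)),
        Fin.val_succ]
    · rw [if_neg h, Fin.succAbove_of_castSucc_lt _ _ (Fin.lt_def.2 (by simp; omega)),
        Fin.val_castSucc, add_zero]
  have hget : (minorWord k (j : ℕ) s).getD ((b : ℕ) + k * (a : ℕ)) false =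
      s.getD ((b : ℕ) + (if (j : ℕ) ≤ b then 1 else 0) + (k + 1) * ((a : ℕ) + 1)) false := by
    unfold minorWord
    rw [List.getD_eq_getElem?_getD (l := List.map _ _), List.getElem?_map, List.getElem?_range ht,
      Option.map_some, Option.getD_some, hmod, hdiv]
  simp only [matOfWord, Matrix.of_apply, Matrix.submatrix_apply]
  rw [hget, hidx]

/-- **Laplace expansion of the permanent in the word encoding** (registered stub
`stub_laplaceWord`): the permanent of the empty word matrix is `1`, and for a `(k+1) × (k+1)`
matrix word `s`, `permWord (k+1) s = Σ_{j ≤ k} s[j] · permWord k (minorWord k j s)`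
(`laplaceSum k s (permWord k)`), i.e. H. Minc, *Permanents* (1978), §1.2, row-`0` expansion
(tree `Matrix.permanent_eq_sum_row_zero`) read through `matOfWord_minorWord`. [folklore] -/
theorem stub_laplaceWord :
    (∀ s : List Bool, permWord 0 s = 1) ∧
      ∀ (k : ℕ) (s : List Bool), permWord (k + 1) s = laplaceSum k s (permWord k) := by
  refine ⟨fun s => Matrix.permanent_isEmpty, fun k s => ?_⟩
  unfold permWord laplaceSum
  rw [Matrix.permanent_eq_sum_row_zero (matOfWord (k + 1) s), sum_map_range_eq_sum_univ]
  refine Finset.sum_congr rfl fun j _ => ?_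
  have h0 : matOfWord (k + 1) s 0 j = if s.getD (j : ℕ) false then 1 else 0 := by
    simp [matOfWord]
  rw [← matOfWord_minorWord k s j, h0, boole_mul]

end Summit.PneNP.PneNP.Theorems.PermCert
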